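import Summits.Ventures.Crystal3D.Theorems.StickyWulffConstantGenericWallFloorStackLedgerLocalTools
import Summits.Ventures.Crystal3D.Theorems.StickyWulffConstantGenericWallFloorExitCertified
import HarnessLib

/-!
# `StarPairCoaxial`: ONE stars-only input implies both double-end inputs of the localised stack ledger
# (`DoubleStarCoaxialAt`, R39d, and `CapPairCoaxial`, R39e) — crux `GenericWallFloor`, line `WallLedgerG`

HONEST FRAMING. Part of the venture `Summits/Ventures/Crystal3D` (cell `crystal3d-full`), helper
`--supports` the crux `GenericWallFloor` (stmt-Ventures-19480) of `route-Ventures-StickyWulffConstant`,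
registered line `WallLedgerG`, open stub `stub_twoSlabAdhesion` (general fillings).  The merge localisation of
the stack ledger (seat 19480-p2 g3: `…StackWalkReverse/…Rigidity/…StarExclusion/…Injective/…MultiStarCount/
…StackLedgerLocalTools`) prices coincident walk ends through TWO named inputs, both of the shape «two walker
certificates at one ball + an eleventh contact off the two closed stars ⇒ the two top lattices are co-axial»:
`DoubleStarCoaxialAt A₁ A₂` (both predecessors carry the full fcc shell; certified, R39d) and `CapPairCoaxial`
(at least one predecessor is an exact twin cap; R39e, uncertified).  Both only USE, of the predecessor clusters,
the five balls of each closed vertex star.  This file names the common strengthening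

* `StarPairCoaxial` — in a `1`-separated configuration, a ball `e` OWNING the closed stars of `−v₁` in `F₁` and of
  `−v₂` in `F₂` (`e + Fᵢ w ∈ X` for `⟪w, vᵢ⟫ < 0`; nothing about shells) with an eleventh contact off the two
  stars has co-axial linear lattices `F₁·Λ₀`, `F₂·Λ₀`;

and proves `StarPairCoaxial → CapPairCoaxial`, `StarPairCoaxial → ∀ A₁ A₂, DoubleStarCoaxialAt A₁ A₂`, and the
covering form consumed by `card_contacts_add_card_le_twelve` (`cover_of_starPair`: non-co-axial owned stars cover
the contacts of `e`).  So ONE certificate (R39d's branch and bound with the ten star balls as the only obstacles)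
would discharge both inputs.  Evidence that `StarPairCoaxial` is true (seat 19480-p1 g5, kit j297869/j297892,
evidence on the item): over random relative rotations the separation slack of a degree-11 double star is < 0
everywhere found (2048 + 8×256 restarts, sup ≈ −4·10⁻⁵), approaching 0 only at the co-axial (Σ3-twin / lattice
symmetry) configurations; coincidence strata likewise.

WHAT THIS IS NOT: `StarPairCoaxial` is an INPUT (uncertified); no walk, no ledger, not the stub; F-C1 not moved.
-/

noncomputable section

namespace Summit.Ventures.Crystal3D.Theorems

open Summit.Ventures.Crystal3D Finset
open Literature.MathematicalPhysics.StatisticalMechanics (fccStacking barlowStacking IsHaggSeq)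
open scoped InnerProductSpace

variable {X : Finset (EuclideanSpace ℝ (Fin 3))}

/-- **THE STARS-ONLY INPUT `StarPairCoaxial`** (NOT proved here).  In a `1`-separated configuration `X`: a ball
`e ∈ X` owning the closed vertex stars of `−v₁` in the frame `F₁` and of `−v₂` in the frame `F₂` (the five balls
`e + Fᵢ w`, `⟪w, vᵢ⟫ < 0`, are in `X`), with an eleventh contact `y` off these ten balls, has CO-AXIAL linear
lattices `F₁·Λ₀`, `F₂·Λ₀` (a common Barlow frame). -/
def StarPairCoaxial : Prop :=
  ∀ (F₁ F₂ : EuclideanSpace ℝ (Fin 3) ≃ₗᵢ[ℝ] EuclideanSpace ℝ (Fin 3)), ∀ v₁ ∈ fccSlots, ∀ v₂ ∈ fccSlots,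
    ∀ (X : Finset (EuclideanSpace ℝ (Fin 3))), (∀ p ∈ X, ∀ q ∈ X, p ≠ q → 1 ≤ dist p q) →
    ∀ e ∈ X, (∀ w ∈ fccSlots, ⟪w, v₁⟫_ℝ < 0 → e + F₁ w ∈ X) → (∀ w ∈ fccSlots, ⟪w, v₂⟫_ℝ < 0 → e + F₂ w ∈ X) →
    ∀ y ∈ X, dist e y = 1 →
      (∀ w ∈ fccSlots, ⟪w, v₁⟫_ℝ < 0 → y ≠ e + F₁ w) → (∀ w ∈ fccSlots, ⟪w, v₂⟫_ℝ < 0 → y ≠ e + F₂ w) →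
      ∃ (L : EuclideanSpace ℝ (Fin 3) ≃ₗᵢ[ℝ] EuclideanSpace ℝ (Fin 3))
        (s₁ s₂ : EuclideanSpace ℝ (Fin 3)) (σ σ' : ℤ → ℤ), IsHaggSeq σ ∧ IsHaggSeq σ' ∧
        F₁ '' fccStacking 1 (Real.sqrt (2 / 3)) ⊆ (fun p => L p + s₁) '' barlowStacking 1 (Real.sqrt (2 / 3)) σ ∧
        F₂ '' fccStacking 1 (Real.sqrt (2 / 3)) ⊆ (fun p => L p + s₂) '' barlowStacking 1 (Real.sqrt (2 / 3)) σ'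

/-- A full predecessor shell hands `e` its closed star: `e + A w ∈ X` for `⟪w, u⟫ < 0`. -/
theorem star_owned_of_full_shell (A : EuclideanSpace ℝ (Fin 3) ≃ₗᵢ[ℝ] EuclideanSpace ℝ (Fin 3))
    {u : EuclideanSpace ℝ (Fin 3)} (hu : u ∈ fccSlots) {e : EuclideanSpace ℝ (Fin 3)}
    (hd : e - A u ∈ X) (hfull : ∀ w ∈ fccSlots, e - A u + A w ∈ X) :
    ∀ w ∈ fccSlots, ⟪w, u⟫_ℝ < 0 → e + A w ∈ X := fun w hw hlt =>
  exit_owns_closedStar A hu hd hfull hw (by rwa [LinearIsometryEquiv.inner_map_map])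

/-- A strong walker certificate (`WalkCertified12`, either branch) hands `e` its closed star. -/
theorem star_owned_of_walkCertified12 {F : EuclideanSpace ℝ (Fin 3) ≃ₗᵢ[ℝ] EuclideanSpace ℝ (Fin 3)}
    {v : EuclideanSpace ℝ (Fin 3)} (hv : v ∈ fccSlots) {e : EuclideanSpace ℝ (Fin 3)}
    (hC : WalkCertified12 X e ⟨F, v, 0⟩) : ∀ w ∈ fccSlots, ⟪w, v⟫_ℝ < 0 → e + F w ∈ X :=
  star_owned_of_walkCertified (e := ⟨F, v, 0⟩) hv hC.walkCertified

/-- **`StarPairCoaxial → CapPairCoaxial`** (R39e is a special case of the stars-only input). -/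
theorem capPairCoaxial_of_starPair (h : StarPairCoaxial) : CapPairCoaxial := by
  intro F₁ F₂ v₁ hv₁ v₂ hv₂ X hX e he n₀ hcap hC₂ y hy hd hoff₁ hoff₂
  have hown₁ : ∀ w ∈ fccSlots, ⟪w, v₁⟫_ℝ < 0 → e + F₁ w ∈ X :=
    star_owned_of_walkCertified12 hv₁ (Or.inr ⟨n₀, hcap⟩)
  have hown₂ : ∀ w ∈ fccSlots, ⟪w, v₂⟫_ℝ < 0 → e + F₂ w ∈ X := star_owned_of_walkCertified12 hv₂ hC₂
  exact h F₁ F₂ v₁ hv₁ v₂ hv₂ X hX e he hown₁ hown₂ y hy hd hoff₁ hoff₂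

/-- **`StarPairCoaxial → DoubleStarCoaxialAt A₁ A₂` for every pair of frames** (R39d's statement is a special
case of the stars-only input). -/
theorem doubleStarCoaxialAt_of_starPair (h : StarPairCoaxial)
    (A₁ A₂ : EuclideanSpace ℝ (Fin 3) ≃ₗᵢ[ℝ] EuclideanSpace ℝ (Fin 3)) : DoubleStarCoaxialAt A₁ A₂ := by
  intro u₁ hu₁ u₂ hu₂ X hX e he hd₁ hfull₁ hd₂ hfull₂ y hy hd hoff₁ hoff₂
  exact h A₁ A₂ u₁ hu₁ u₂ hu₂ X hX e he (star_owned_of_full_shell A₁ hu₁ hd₁ hfull₁)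
    (star_owned_of_full_shell A₂ hu₂ hd₂ hfull₂) y hy hd hoff₁ hoff₂

/-- Membership in a star set, unfolded. -/
theorem mem_starSet_iff {e q : EuclideanSpace ℝ (Fin 3)} {F : EuclideanSpace ℝ (Fin 3) ≃ₗᵢ[ℝ] EuclideanSpace ℝ (Fin 3)}
    {v : EuclideanSpace ℝ (Fin 3)} : q ∈ starSet e F v ↔ ∃ w ∈ fccSlots, ⟪w, v⟫_ℝ < 0 ∧ q = e + F w := by
  classical
  unfold starSet
  rw [Finset.mem_image]
  constructor
  · rintro ⟨w, hw, rfl⟩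
    obtain ⟨hw, hlt⟩ := Finset.mem_filter.1 hw
    exact ⟨w, hw, hlt, rfl⟩
  · rintro ⟨w, hw, hlt, rfl⟩
    exact ⟨w, Finset.mem_filter.2 ⟨hw, hlt⟩, rfl⟩

/-- **The covering form** (the `hcov` hypothesis of `card_contacts_add_card_le_twelve`): under `StarPairCoaxial`,
two OWNED closed stars at `e` with NON-co-axial lattices cover the contacts of `e`. -/
theorem cover_of_starPair (h : StarPairCoaxial) (hX : ∀ p ∈ X, ∀ q ∈ X, p ≠ q → 1 ≤ dist p q)
    {F₁ F₂ : EuclideanSpace ℝ (Fin 3) ≃ₗᵢ[ℝ] EuclideanSpace ℝ (Fin 3)} {v₁ v₂ : EuclideanSpace ℝ (Fin 3)}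
    (hv₁ : v₁ ∈ fccSlots) (hv₂ : v₂ ∈ fccSlots) {e : EuclideanSpace ℝ (Fin 3)} (he : e ∈ X)
    (hown₁ : ∀ w ∈ fccSlots, ⟪w, v₁⟫_ℝ < 0 → e + F₁ w ∈ X) (hown₂ : ∀ w ∈ fccSlots, ⟪w, v₂⟫_ℝ < 0 → e + F₂ w ∈ X)
    (hnc : ¬ ∃ (L : EuclideanSpace ℝ (Fin 3) ≃ₗᵢ[ℝ] EuclideanSpace ℝ (Fin 3))
        (s₁ s₂ : EuclideanSpace ℝ (Fin 3)) (σ σ' : ℤ → ℤ), IsHaggSeq σ ∧ IsHaggSeq σ' ∧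
        F₁ '' fccStacking 1 (Real.sqrt (2 / 3)) ⊆ (fun p => L p + s₁) '' barlowStacking 1 (Real.sqrt (2 / 3)) σ ∧
        F₂ '' fccStacking 1 (Real.sqrt (2 / 3)) ⊆ (fun p => L p + s₂) '' barlowStacking 1 (Real.sqrt (2 / 3)) σ') :
    ∀ q ∈ X, dist e q = 1 → q ∈ starSet e F₁ v₁ ∪ starSet e F₂ v₂ := by
  intro q hq hdq
  by_contra hnot
  rw [Finset.mem_union, not_or] at hnot
  have hoff₁ : ∀ w ∈ fccSlots, ⟪w, v₁⟫_ℝ < 0 → q ≠ e + F₁ w := fun w hw hlt hEq =>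
    hnot.1 (mem_starSet_iff.2 ⟨w, hw, hlt, hEq⟩)
  have hoff₂ : ∀ w ∈ fccSlots, ⟪w, v₂⟫_ℝ < 0 → q ≠ e + F₂ w := fun w hw hlt hEq =>
    hnot.2 (mem_starSet_iff.2 ⟨w, hw, hlt, hEq⟩)
  exact hnc (h F₁ F₂ v₁ hv₁ v₂ hv₂ X hX e he hown₁ hown₂ q hq hdq hoff₁ hoff₂)

/-- **Pricing one pair of strong certificates from the single input** (the `StarPairCoaxial` version of
`coaxial_of_pair_certified`: no case split on the certificate types). -/
theorem coaxial_of_pair_certified12_of_starPair (h : StarPairCoaxial) (hX : ∀ p ∈ X, ∀ q ∈ X, p ≠ q → 1 ≤ dist p q)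
    {F₁ F₂ : EuclideanSpace ℝ (Fin 3) ≃ₗᵢ[ℝ] EuclideanSpace ℝ (Fin 3)} {v₁ v₂ : EuclideanSpace ℝ (Fin 3)}
    (hv₁ : v₁ ∈ fccSlots) (hv₂ : v₂ ∈ fccSlots) {e : EuclideanSpace ℝ (Fin 3)} (he : e ∈ X)
    (hC₁ : WalkCertified12 X e ⟨F₁, v₁, 0⟩) (hC₂ : WalkCertified12 X e ⟨F₂, v₂, 0⟩)
    {y : EuclideanSpace ℝ (Fin 3)} (hy : y ∈ X) (hd : dist e y = 1)
    (hoff₁ : ∀ w ∈ fccSlots, ⟪w, v₁⟫_ℝ < 0 → y ≠ e + F₁ w) (hoff₂ : ∀ w ∈ fccSlots, ⟪w, v₂⟫_ℝ < 0 → y ≠ e + F₂ w) :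
    ∃ (L : EuclideanSpace ℝ (Fin 3) ≃ₗᵢ[ℝ] EuclideanSpace ℝ (Fin 3))
      (s₁ s₂ : EuclideanSpace ℝ (Fin 3)) (σ σ' : ℤ → ℤ), IsHaggSeq σ ∧ IsHaggSeq σ' ∧
      F₁ '' fccStacking 1 (Real.sqrt (2 / 3)) ⊆ (fun p => L p + s₁) '' barlowStacking 1 (Real.sqrt (2 / 3)) σ ∧
      F₂ '' fccStacking 1 (Real.sqrt (2 / 3)) ⊆ (fun p => L p + s₂) '' barlowStacking 1 (Real.sqrt (2 / 3)) σ' :=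
  h F₁ F₂ v₁ hv₁ v₂ hv₂ X hX e he (star_owned_of_walkCertified12 hv₁ hC₁) (star_owned_of_walkCertified12 hv₂ hC₂)
    y hy hd hoff₁ hoff₂

end Summit.Ventures.Crystal3D.Theorems

end
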